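import Summits.BirchSwinnertonDyer.BirchSwinnertonDyer.Theorems.ByReductionTypeAtTwoOrdKatoHalfAtTwoIsoKatoIntSignFreeDoor
import Summits.BirchSwinnertonDyer.BirchSwinnertonDyer.Theorems.ByReductionTypeAtTwoOrdKatoHalfAtTwoIsoOptimalOff514OptimalMember
import HarnessLib

/-!
# Route ByReductionTypeAtTwo, crux `OrdKatoHalfAtTwoIso` (stmt-BirchSwinnertonDyer-19573), child B7′
# (stmt-BirchSwinnertonDyer-23921): the IMAGE-FREE `μ`-door — zeta classes in Coleman coordinates + `Sel₀(E/ℚ_∞)[2]`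
# finite + analytic `μ₂ = 0` ⇒ `μ(X(E/ℚ_∞)) = 0` — and the `C₃` part of B7′ BY NAME from it (theorems only)

Seat `cruxlead-stmt-BirchSwinnertonDyer-19573-w2` GEN 3 (prover WIDTH under LEAD cruxlead-19573 g5; HOME
`run/shared/lean/pub/bsd-2adic/`; `--supports` stmt-BirchSwinnertonDyer-23921; pen RC-386 (iii) «B7′ lane, the C₃-image case
first»). HONEST FRAMING (cell bsd-2adic): BSD is not proved by any of this; neither the crux nor B7′ nor its `C₃` part is
proved here; THEOREMS ONLY — the beyond-print inputs are written INLINE as displayed hypotheses (no definition, no named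
fact, nothing asserted); every door is CONDITIONAL on them.

WHY THIS FILE. On the `C₃` part of B7′'s habitat (`E[2]` irreducible, `ρ̄_{W,2}` NOT onto: image of order `3`; `Δ_W > 0`
and `K₃ = ℚ(E[2])` a cyclic cubic field) B7′ is exactly `KatoMuPartIrrNotSurjectiveTwo` (p680193: Kato's `μ`-part at `W`
itself), and since `ϖ` is a `2`-adic unit and `μ_an = 0` there (tree theorems), its content is `μ(X(E/ℚ_∞)) = 0`. The
line's `μ = 0` engine for `ρ̄₂` ONTO (`mu_eq_zero_of_hasZetaColemanMuInputsAtTwo_of_core_signFree`, p682426; lead p678187)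
reads: zeta-Coleman package (F1μ) + CORE THEOREM A (a GENUINE Euler-system class `∉ 2𝐇¹` kills the `E[2]`-lifts of `Sel₀`
by a power of `T`, via Chebotarev TRANSPOSITIONS — unavailable for image `C₃`, where no element of the image has a
one-dimensional fixed space: the `EulerSystemBigImageAtSmallImage` barrier) + analytic `μ₂ = 0`. TWO OBSERVATIONS:
(i) the core theorem enters that bookkeeping ONLY through its output «`Sel₀(E/ℚ_∞, E[2^∞])[2]` is finite» (⇒ `X₀/2X₀`
finite ⇒ `length_(2) X₀ = 0`); (ii) the SPAN CLAUSE of the package («`Z` inside the `Λ`-span of GENUINE `2`-adic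
Euler-system classes») only feeds the core theorem — the `μ`-bookkeeping itself needs no genuineness, indeed no `𝐇¹` at
all: only an ideal `P ⊆ Λ`, a submodule `M ⊆ P` killed by `τ : P → X`, exactness `P → X ↠ X₀`, and ONE element
`s·G₁ ∈ M` with `s ∉ (2)`, `ι G₁ = L₂(f, α)`. After the crux-triage's NEGATIVE LEMMA p691215 (pen RC-388: on `0 < Δ` —
where ALL `C₃` curves live — every GENUINE class is `2`-divisible in `𝐇¹_Γ ≅ Λ` once `loc_∞ ≢ 0`, so the span clause +
image clause of F1μ⁺ cannot both hold there) this matters: the span-free package is exactly what survives for the HALF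
classes `y` (`2y` genuine, `col(y) = u·L₂`; RC-388 (α)), and it is all the `μ`-door consumes. So:

* `mu_eq_zero_of_unitMultiple_of_exact_of_finite_fineSelmer_pTorsion` — **SPAN-FREE, IMAGE-FREE `μ`-BOOKKEEPING
  (KERNEL)**: cyclotomic `(κ, γ)`, data `D, Y`; an ideal `P`, `M ⊆ P`, `τ : P → X` killing `M`, `π : X ↠ X₀` exact after
  `τ`, `s·G₁ ∈ M` with `s, G₁ ∉ (2)`, and `Sel₀(E/ℚ_∞)[2]` finite ⇒ `μ(D.X) = 0`. No newform, no image, no `𝐇¹`, no Euler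
  system, no Chebotarev, no core Theorem A.
* `mu_eq_zero_of_hasZetaColemanMuInputsAtTwo_of_finite_fineSelmer_pTorsion` — the same from the line's package
  `HasZetaColemanMuInputsAtTwo` (its span clause DISCARDED) + analytic `μ₂ = 0` for `E[2]` irreducible
  (`AnalyticMuTwo.exists_norm_padicLCoeff_two_eq_one`, p642753) + INT2-AUTO; any image (`S₃` or `C₃`), any sign.
* `katoMuPartAtTwo_of_colemanMuPackage_of_finite_fineSelmer_irr` — `X5.O1.KatoMuPartAtTwo W` at ONE curve (good ordinary at
  `2`, `E[2]` irreducible) from the span-free package for all cyclotomic data and «`Sel₀(E/ℚ_∞)[2]` finite».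
* `katoMuPartIrrNotSurjectiveTwo_of_colemanMuPackage_of_finite_fineSelmer` — **the `C₃` part of B7′ BY NAME from TWO
  displayed binders**: (Colμ-C₃) the SPAN-FREE zeta/half-class Coleman package on the `C₃` habitat (a READING of Kato
  §§12–17 at `2` for the classes `y` with `col(y) = u·L₂(f, α)`, memo tier, nothing asserted; F-27a / p691215 say these are
  the HALF classes on `0 < Δ`) and (A₂-C₃) «`Sel₀(E/ℚ_∞, E[2^∞])[2]` finite» on the `C₃` habitat = Coates–Sujatha
  Conjecture A at `2` there in Greenberg's `Sel₀[p]`-form (LNM 1716 §1 p. 60), for which the cell memo MEMO-7 Prop. 2.4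
  gives a print-adjacent road (Shapiro to the cyclic cubic `K₃`, `2` split in `K₃`, Ferrero–Washington for the abelian
  field `K₃`; nothing of it asserted here).
* `katoMuPartOff514_of_C3_binders_of_optimalMemberReducible` — B7′ BY NAME from: Abbes–Ullmo, modularity, the two `C₃`
  binders, and the optimal-member binder RESTRICTED TO THE REDUCIBLE PART (p692385 `katoMuPartOff514Reducible_of_optimalMember`
  + p680193 `katoMuPartOff514_of_split`).

What this is NOT: not a proof of Conjecture A at `2` on the `C₃` habitat, not a proof of any Coleman-image reading; the
`C₃` part and B7′ stay OPEN; no census number moves (kit 0 in this seat).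

References: [Kato2004Asterisque] Thm 12.6, (14.9.3), 16.6, 17.11, §17.13 (pp. 279–280); [GreenbergLNM1716] §1 p. 60,
Conj. 1.11; [CoatesSujatha2005] Conj. A; [FerreroWashington1979]; [MazurTateTeitelbaum1986Invent] §I.12; MEMO-7 Prop. 2.4
(HOME); pen RC-387/RC-388; the line's files p642753, p678187, p680193, p682426, p691215, p692385.
-/

set_option autoImplicit false
set_option linter.dupNamespace false

noncomputable section

open scoped Classical MatrixGroups ModularForm NumberField
open CongruenceSubgroup WeierstrassCurve Field IsDedekindDomain NumberField
open Literature.NumberTheory.GaloisRepresentations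
open Literature.NumberTheory.GaloisCohomology
open Literature.NumberTheory.EllipticCurves Literature.NumberTheory.EllipticCurves.ModularForms
open Literature.NumberTheory.EllipticCurves.Kato2004
  Literature.NumberTheory.EllipticCurves.Kato2004.EulerSystemValues
open Literature.NumberTheory.EllipticCurves.Rank1Residual
open Literature.NumberTheory.EllipticCurves.Greenberg1999
open Summit.BirchSwinnertonDyer.BirchSwinnertonDyer.Theorems.Rank1ResidualX1Defs
  Summit.BirchSwinnertonDyer.BirchSwinnertonDyer.Rank1Residual
  Summit.BirchSwinnertonDyer.BirchSwinnertonDyer.Rank1Residual.CoreAssembly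
open Summit.BirchSwinnertonDyer.Rank1Residual Summit.BirchSwinnertonDyer.Rank1Residual.X5
open Summit.BirchSwinnertonDyer.BirchSwinnertonDyer.Theorems.OrdKatoOptimalAtTwo
  Summit.BirchSwinnertonDyer.BirchSwinnertonDyer.Theorems.OrdKatoIntAtTwo
open Summit.BirchSwinnertonDyer.BirchSwinnertonDyer.Theses.ByReductionTypeAtTwo

namespace Summit.BirchSwinnertonDyer.BirchSwinnertonDyer.Theorems.SteinbergFibreAtTwo

/-! ## §1 Per datum: the SPAN-FREE, IMAGE-FREE `μ`-bookkeeping -/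

section PerDatum

variable {W : WeierstrassCurve ℚ} [W.IsElliptic] [W.IsGloballyMinimal]
  {κ : ZpExtension ℚ 2} {γ : absoluteGaloisGroup ℚ}
  {D : W.SelmerDualData κ γ} {Y : W.FineSelmerDualData κ γ}

omit [W.IsGloballyMinimal] in
/-- **SPAN-FREE, IMAGE-FREE `μ`-BOOKKEEPING (KERNEL).** For the cyclotomic `ℤ₂`-extension `κ` with topological generator
`γ`, a Selmer dual datum `D` (`X = X(E/ℚ_∞)`) and a fine Selmer dual datum `Y` (`X₀`): suppose an ideal `P ⊆ Λ`, a
submodule `M ⊆ P`, a `Λ`-map `τ : P → X` killing `M` and a surjection `π : X ↠ X₀` exact after `τ`, an element `G₁ ∉ (2)`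
and `s ∉ (2)` with `s·G₁ ∈ M`; if `Sel₀(ℚ_∞, E[2^∞])[2]` is finite then `μ(X) = 0`. Proof: `length_(2)(P/M) ≤
length_(2)(Λ/M) = 0` (`s·G₁ ∈ M ∖ (2)`), `length_(2) X₀ = 0` (`X₀/2X₀` finite,
`FineSelmerDualData.finite_quotient_augIdealP_of_finite_pTorsion`), additivity of `length_(2)` along `P/M → X ↠ X₀`.
The lead's bookkeeping (p678187 / p682426) with the core-Theorem-A call replaced by its OUTPUT and the Euler-system span
clause dropped: NO newform, NO image hypothesis, NO `𝐇¹`, NO Chebotarev.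
[cite: Kato2004Asterisque, §17.13 (pp. 279–280) (shape of the sequence)] [cite: GreenbergLNM1716, §1 p. 60 (after Conj. 1.3)] -/
theorem mu_eq_zero_of_unitMultiple_of_exact_of_finite_fineSelmer_pTorsion (hκ : κ.IsCyclotomic)
    (hγ : κ.IsTopGenerator γ) {G₁ : IwasawaAlgebra 2} (hμL : G₁ ∉ IwasawaAlgebra.augIdealP 2)
    (P : Submodule (IwasawaAlgebra 2) (IwasawaAlgebra 2)) (M : Submodule (IwasawaAlgebra 2) P)
    (τ : P →ₗ[IwasawaAlgebra 2] D.X) (π : D.X →ₗ[IwasawaAlgebra 2] Y.X)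
    (hτM : ∀ m ∈ M, τ m = 0) (hπs : Function.Surjective π) (hπ : Function.Exact τ π)
    (himg : ∃ s : IwasawaAlgebra 2, s ∉ IwasawaAlgebra.augIdealP 2 ∧ s * G₁ ∈ Submodule.map P.subtype M)
    (hfin : Set.Finite {s : W.fineSelmerInfty κ | 2 • s = 0}) : D.mu = 0 := by
  -- `X(E/ℚ_∞)` is finitely generated over `Λ` for the cyclotomic `κ` (PROVED in the tree, Nakayama)
  haveI : Module.Finite (IwasawaAlgebra 2) D.X :=
    WeierstrassCurve.SelmerDualData.module_finite_of_isCyclotomic W κ hκ D hγ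
  haveI : Module.Finite (IwasawaAlgebra 2) Y.X := Module.Finite.of_surjective π hπs
  obtain ⟨s, hs, hsGM⟩ := himg
  -- `Sel₀(E/ℚ_∞)[2]` finite (displayed) ⇒ `X₀/2X₀` finite
  haveI : Finite (Y.X ⧸ (IwasawaAlgebra.augIdealP 2 • (⊤ : Submodule (IwasawaAlgebra 2) Y.X))) :=
    Y.finite_quotient_augIdealP_of_finite_pTorsion hfin
  -- bookkeeping at `𝔭 = (2)`
  let 𝔭 : PrimeSpectrum (IwasawaAlgebra 2) :=
    ⟨IwasawaAlgebra.augIdealP 2, IwasawaAlgebra.isPrime_augIdealP_holds 2⟩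
  have hY0 : Module.lengthAt (IwasawaAlgebra 2) Y.X 𝔭 = 0 :=
    KatoMuSkeleton.lengthAt_eq_zero_of_finite_quotient_p (M := Y.X) 𝔭 rfl
  have hX0 : Module.lengthAt (IwasawaAlgebra 2) D.X 𝔭 = 0 := by
    set M' : Ideal (IwasawaAlgebra 2) := Submodule.map P.subtype M with hM'
    have hnot : ¬ M' ≤ 𝔭.asIdeal := fun hle => by
      rcases 𝔭.isPrime.mem_or_mem (hle hsGM) with h' | h'
      · exact hs h'
      · exact hμL h'
    have hΛM : Module.lengthAt (IwasawaAlgebra 2) (IwasawaAlgebra 2 ⧸ M') 𝔭 = 0 :=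
      Module.lengthAt_quotient_eq_zero_of_not_le hnot
    have hPM : Module.lengthAt (IwasawaAlgebra 2) (P ⧸ M) 𝔭 = 0 := by
      refine le_antisymm ?_ bot_le
      rw [← hΛM]
      refine Module.lengthAt_le_of_injective (Submodule.mapQ M M' P.subtype fun y hy => ⟨y, hy, rfl⟩) ?_ 𝔭
      rw [← LinearMap.ker_eq_bot, Submodule.ker_mapQ, hM',
        Submodule.comap_map_eq_of_injective P.injective_subtype, Submodule.mkQ_map_self]
    have hle : M ≤ LinearMap.ker τ := fun m hm => hτM m hm
    let f' : (P ⧸ M) →ₗ[IwasawaAlgebra 2] D.X := M.liftQ τ hle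
    have hf' : Function.Exact f' π := by
      rw [LinearMap.exact_iff, Submodule.range_liftQ]
      exact LinearMap.exact_iff.mp hπ
    refine le_antisymm ?_ bot_le
    calc Module.lengthAt (IwasawaAlgebra 2) D.X 𝔭
        ≤ Module.lengthAt (IwasawaAlgebra 2) (P ⧸ M) 𝔭 + Module.lengthAt (IwasawaAlgebra 2) Y.X 𝔭 :=
          Module.lengthAt_le_add_of_exact f' π hf' 𝔭
      _ = 0 := by rw [hPM, hY0, zero_add]
  change muInvariant 2 D.X = 0
  rw [muInvariant_eq_toNat_lengthAt 2 D.X 𝔭 rfl, hX0]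
  rfl

variable [ContinuousSMul ℤ_[2] (W.tateModule 2)] [Module.Free ℤ_[2] (W.tateModule 2)]
  [Module.Finite ℤ_[2] (W.tateModule 2)] {N : ℕ} {f : CuspForm (Gamma0 N) 2} {hκ : κ.IsCyclotomic}

/-- **The line's package `HasZetaColemanMuInputsAtTwo` implies the SPAN-FREE Coleman `μ`-package** (forget `𝐇¹`, the
zeta submodule `Z` and its genuineness; keep `P`, `M := ℓ(Z)`, `τ`, `π` and the image clause). So every habitat on which
child 23959's reading holds feeds the `μ`-door below; on `0 < Δ` (p691215) the span-free package is the honest currency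
(half classes). [folklore] -/
theorem colemanMuPackage_of_hasZetaColemanMuInputsAtTwo (h : HasZetaColemanMuInputsAtTwo W f κ γ hκ D Y) :
    ∃ (P : Submodule (IwasawaAlgebra 2) (IwasawaAlgebra 2)) (M : Submodule (IwasawaAlgebra 2) P)
          (τ : P →ₗ[IwasawaAlgebra 2] D.X) (π : D.X →ₗ[IwasawaAlgebra 2] Y.X),
          (∀ m ∈ M, τ m = 0) ∧ Function.Surjective π ∧ Function.Exact τ π ∧
          ∀ G₁ : IwasawaAlgebra 2, iwasawaToPowerSeries 2 G₁ = padicLFunction f (unitRoot W 2 : ℚ_[2]) →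
            ∃ s : IwasawaAlgebra 2, s ∉ IwasawaAlgebra.augIdealP 2 ∧ s * G₁ ∈ Submodule.map P.subtype M := by
  obtain ⟨I, Z, P, ℓ, τ, π, -, hτℓ, hπs, hπ, himg⟩ := h
  refine ⟨P, Submodule.map ℓ Z, τ, π, ?_, hπs, hπ, fun G₁ hG₁ ↦ ?_⟩
  · rintro _ ⟨z, hz, rfl⟩
    exact hτℓ z hz
  · obtain ⟨s, hs, hsG⟩ := himg G₁ hG₁
    exact ⟨s, hs, by rw [← Submodule.map_comp]; exact hsG⟩

/-- **The line's package `HasZetaColemanMuInputsAtTwo` (span clause DISCARDED) + an analytic unit coefficient +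
`Sel₀(E/ℚ_∞)[2]` finite ⇒ `μ(X) = 0`** — for `W` good ordinary at `2`, a newform `f`, the cyclotomic `(κ, γ)`: INT2-AUTO
gives `G₁` with `ι G₁ = L₂(f, α)`, the unit coefficient gives `G₁ ∉ (2)`, the package gives `P`, `M = ℓ(Z)`, `τ`, `π` and
the image clause; then `mu_eq_zero_of_unitMultiple_of_exact_of_finite_fineSelmer_pTorsion`. NO image hypothesis, NO core
Theorem A. [cite: Kato2004Asterisque, §17.13 (pp. 279–280)] [cite: MazurTateTeitelbaum1986Invent, §I.12] -/
theorem mu_eq_zero_of_hasZetaColemanMuInputsAtTwo_of_unitCoeff_of_finite_fineSelmer_pTorsion [NeZero N]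
    (hord : IsOrdinaryAt W 2) (hf : IsNewformOf W f) (hγ : κ.IsTopGenerator γ)
    (hunit : ∃ n : ℕ, ‖PowerSeries.coeff n (padicLFunction f (unitRoot W 2 : ℚ_[2]))‖ = 1)
    (h : HasZetaColemanMuInputsAtTwo W f κ γ hκ D Y)
    (hfin : Set.Finite {s : W.fineSelmerInfty κ | 2 • s = 0}) : D.mu = 0 := by
  obtain ⟨P, M, τ, π, hτM, hπs, hπ, himg⟩ := colemanMuPackage_of_hasZetaColemanMuInputsAtTwo h
  -- `L₂(f, α) ∈ ι(Λ)` (INT2-AUTO, PROVED) and the analytic unit coefficient: `G₁ ∉ (2)`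
  obtain ⟨G₁, hG₁⟩ := exists_iwasawaToPowerSeries_eq_padicLFunction_two_auto (W := W) (f := f) hord hf
  have hμL : G₁ ∉ IwasawaAlgebra.augIdealP 2 := not_mem_augIdealP_of_norm_coeff_eq_one hG₁ hunit
  exact mu_eq_zero_of_unitMultiple_of_exact_of_finite_fineSelmer_pTorsion hκ hγ hμL P M τ π hτM hπs hπ
    (himg G₁ hG₁) hfin

/-- **IMAGE-FREE `μ`-door on «good ordinary at `2`, `E[2]` IRREDUCIBLE»** (image `S₃` OR `C₃`, either sign of `Δ`):
`HasZetaColemanMuInputsAtTwo W f κ γ hκ D Y` (span clause unused) ∧ `Sel₀(E/ℚ_∞)[2]` finite ⇒ `μ(D.X) = 0`; the unit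
coefficient is the tree's analytic `μ₂ = 0` for `E[2]` irreducible (`AnalyticMuTwo.exists_norm_padicLCoeff_two_eq_one`,
p642753). [cite: Kato2004Asterisque, §17.13 (pp. 279–280)] [cite: GreenbergLNM1716, §1 p. 60, Conj. 1.11 (shape)] -/
theorem mu_eq_zero_of_hasZetaColemanMuInputsAtTwo_of_finite_fineSelmer_pTorsion [NeZero N] (hgo : GoodOrd W 2)
    (hirr : W.HasIrreducibleModPGaloisRep 2) (hf : IsNewformOf W f) (hγ : κ.IsTopGenerator γ)
    (h : HasZetaColemanMuInputsAtTwo W f κ γ hκ D Y)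
    (hfin : Set.Finite {s : W.fineSelmerInfty κ | 2 • s = 0}) : D.mu = 0 := by
  have hord : IsOrdinaryAt W 2 := ⟨hgo.1, hgo.2⟩
  obtain ⟨k, hk⟩ := AnalyticMuTwo.exists_norm_padicLCoeff_two_eq_one W hord hirr hf
  exact mu_eq_zero_of_hasZetaColemanMuInputsAtTwo_of_unitCoeff_of_finite_fineSelmer_pTorsion hord hf hγ
    ⟨k, by rw [coeff_padicLFunction]; exact hk⟩ h hfin

end PerDatum


/-! ## §2 The `∀`-forms: Kato's `μ`-part at ONE curve and the `C₃` part of B7′ BY NAME -/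

/-- **`X5.O1.KatoMuPartAtTwo W` at ONE curve `W` (`E[2]` irreducible — image `S₃` or `C₃`, any sign of `Δ`; the
good-ordinary guard is inside `KatoMuPartAtTwo`) from the SPAN-FREE Coleman `μ`-package for all cyclotomic data of `W` and «`Sel₀(E/ℚ_∞)[2]` finite» for
every cyclotomic `κ`** (`μ = 0` ⇒ `2^0 ∣ L₀`; analytic `μ₂ = 0` and INT2-AUTO from the tree). Both inputs displayed inline;
conditional; nothing asserted. [cite: GreenbergLNM1716, §1 p. 60, Conj. 1.11 (shape)] [cite: Kato2004Asterisque, §17.13 (pp. 279–280)]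
[cite: MazurTateTeitelbaum1986Invent, §I.12] -/
theorem katoMuPartAtTwo_of_colemanMuPackage_of_finite_fineSelmer_irr (W : WeierstrassCurve ℚ) [W.IsElliptic]
    [W.IsGloballyMinimal] (hirr : W.HasIrreducibleModPGaloisRep 2)
    (hCW : ∀ {N : ℕ} [NeZero N] (f : CuspForm (Gamma0 N) 2) (κ : ZpExtension ℚ 2) (γ : absoluteGaloisGroup ℚ),
      κ.IsCyclotomic → κ.IsTopGenerator γ → IsCyclotomicVariable 2 γ → IsNewformOf W f →
      ∀ (D : W.SelmerDualData κ γ) (Y : W.FineSelmerDualData κ γ),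
        ∃ (P : Submodule (IwasawaAlgebra 2) (IwasawaAlgebra 2)) (M : Submodule (IwasawaAlgebra 2) P)
          (τ : P →ₗ[IwasawaAlgebra 2] D.X) (π : D.X →ₗ[IwasawaAlgebra 2] Y.X),
          (∀ m ∈ M, τ m = 0) ∧ Function.Surjective π ∧ Function.Exact τ π ∧
          ∀ G₁ : IwasawaAlgebra 2, iwasawaToPowerSeries 2 G₁ = padicLFunction f (unitRoot W 2 : ℚ_[2]) →
            ∃ s : IwasawaAlgebra 2, s ∉ IwasawaAlgebra.augIdealP 2 ∧ s * G₁ ∈ Submodule.map P.subtype M)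
    (hAW : ∀ κ : ZpExtension ℚ 2, κ.IsCyclotomic → Set.Finite {s : W.fineSelmerInfty κ | 2 • s = 0}) :
    O1.KatoMuPartAtTwo W := by
  intro κ γ hκ hγ hγ' hord _ f hf ϖ _ D L₀ _
  obtain ⟨Y⟩ := W.nonempty_fineSelmerDualData κ hγ
  obtain ⟨P, M, τ, π, hτM, hπs, hπ, himg⟩ := hCW f κ γ hκ hγ hγ' hf D Y
  -- `L₂(f, α) ∈ ι(Λ)` (INT2-AUTO) and analytic `μ₂ = 0` for `E[2]` irreducible: `G₁ ∉ (2)`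
  obtain ⟨G₁, hG₁⟩ := exists_iwasawaToPowerSeries_eq_padicLFunction_two_auto (W := W) (f := f) hord hf
  obtain ⟨k, hk⟩ := AnalyticMuTwo.exists_norm_padicLCoeff_two_eq_one W hord hirr hf
  have hμL : G₁ ∉ IwasawaAlgebra.augIdealP 2 :=
    not_mem_augIdealP_of_norm_coeff_eq_one hG₁ ⟨k, by rw [coeff_padicLFunction]; exact hk⟩
  rw [mu_eq_zero_of_unitMultiple_of_exact_of_finite_fineSelmer_pTorsion hκ hγ hμL P M τ π hτM hπs hπ (himg G₁ hG₁)
    (hAW κ hκ), pow_zero, map_one]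
  exact one_dvd _

/-- **The `C₃` part of B7′ BY NAME — `KatoMuPartIrrNotSurjectiveTwo` (p680193) — from TWO displayed binders**:
(Colμ-C₃) `hC3`, the SPAN-FREE Coleman `μ`-package on the habitat «good ordinary at `2`, `E[2]` irreducible, `ρ̄_{W,2}` NOT
onto» for every newform and all cyclotomic data (a READING of Kato §§12–17 at `2` — for the zeta classes or, on `0 < Δ`
where this whole habitat lives, for the HALF classes `y` with `col(y) = u·L₂(f, α)` (pen RC-388 (α), p691215); memo tier,
nothing asserted; implied by child 23959's package wherever that holds, `colemanMuPackage_of_hasZetaColemanMuInputsAtTwo`),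
and (A₂-C₃) `hA3`, «`Sel₀(E/ℚ_∞, E[2^∞])[2]` finite for the cyclotomic `ℤ₂`-extension» on the same habitat (Coates–Sujatha
Conjecture A at `2` there, Greenberg's `Sel₀[p]`-form; MEMO-7 Prop. 2.4 road via the cyclic cubic `2`-division field `K₃`,
`2` split in `K₃`, and Ferrero–Washington for the abelian field `K₃`; nothing asserted). NO core Theorem A, NO Euler-system
non-divisibility, NO Chebotarev. [cite: GreenbergLNM1716, §1 p. 60, Conj. 1.11 (shape)] [cite: CoatesSujatha2005, Conj. A (shape)]
[cite: Kato2004Asterisque, §17.13 (pp. 279–280)] -/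
theorem katoMuPartIrrNotSurjectiveTwo_of_colemanMuPackage_of_finite_fineSelmer
    (hC3 : ∀ (W : WeierstrassCurve ℚ) [W.IsElliptic] [W.IsGloballyMinimal] {N : ℕ} [NeZero N]
      (f : CuspForm (Gamma0 N) 2) (κ : ZpExtension ℚ 2) (γ : absoluteGaloisGroup ℚ),
      κ.IsCyclotomic → IsOrdinaryAt W 2 → W.HasIrreducibleModPGaloisRep 2 → ¬ W.HasSurjectiveModNGaloisRep 2 →
      κ.IsTopGenerator γ → IsCyclotomicVariable 2 γ → IsNewformOf W f →
      ∀ (D : W.SelmerDualData κ γ) (Y : W.FineSelmerDualData κ γ),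
        ∃ (P : Submodule (IwasawaAlgebra 2) (IwasawaAlgebra 2)) (M : Submodule (IwasawaAlgebra 2) P)
          (τ : P →ₗ[IwasawaAlgebra 2] D.X) (π : D.X →ₗ[IwasawaAlgebra 2] Y.X),
          (∀ m ∈ M, τ m = 0) ∧ Function.Surjective π ∧ Function.Exact τ π ∧
          ∀ G₁ : IwasawaAlgebra 2, iwasawaToPowerSeries 2 G₁ = padicLFunction f (unitRoot W 2 : ℚ_[2]) →
            ∃ s : IwasawaAlgebra 2, s ∉ IwasawaAlgebra.augIdealP 2 ∧ s * G₁ ∈ Submodule.map P.subtype M)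
    (hA3 : ∀ (W : WeierstrassCurve ℚ) [W.IsElliptic] [W.IsGloballyMinimal],
      GoodOrd W 2 → W.HasIrreducibleModPGaloisRep 2 → ¬ W.HasSurjectiveModNGaloisRep 2 →
      ∀ κ : ZpExtension ℚ 2, κ.IsCyclotomic → Set.Finite {s : W.fineSelmerInfty κ | 2 • s = 0}) :
    KatoMuPartIrrNotSurjectiveTwo := by
  intro W _ _ hgo hirr hns
  exact katoMuPartAtTwo_of_colemanMuPackage_of_finite_fineSelmer_irr W hirr
    (fun f κ γ hκ hγ hγ' hf D Y ↦ hC3 W f κ γ hκ ⟨hgo.1, hgo.2⟩ hirr hns hγ hγ' hf D Y) (hA3 W hgo hirr hns)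

/-! ## §3 B7′ BY NAME from the `C₃` binders and the optimal-member binder on the reducible part -/

/-- **B7′ `KatoMuPartOff514AtOptimalMemberOfNotSurjectiveTwo` (child stmt-BirchSwinnertonDyer-23921) BY NAME from**:
Abbes–Ullmo (print), modularity `nonempty_modularParametrizationData` (print), the two `C₃` binders (Colμ-C₃) / (A₂-C₃) of
`katoMuPartIrrNotSurjectiveTwo_of_colemanMuPackage_of_finite_fineSelmer`, and the optimal-member binder RESTRICTED TO
`E[2]`-REDUCIBLE curves («`KatoMuPartAtTwo` OR a Prop-5.14 point at every isogenous lattice-optimal member», p692385) —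
assembled by `katoMuPartOff514_of_split` (p680193). Conditional; nothing closed.
[cite: AbbesUllmo1996, Thm. A] [cite: EdixhovenManin1991, Prop. 2] [cite: GreenbergLNM1716, Prop. 5.14, Conj. 1.11 (shape)] -/
theorem katoMuPartOff514_of_C3Binders_of_optimalMemberReducible
    (hAU : abbesUllmo_not_dvd_maninConstant_of_not_dvd_level) (hMod : nonempty_modularParametrizationData)
    (hC3 : ∀ (W : WeierstrassCurve ℚ) [W.IsElliptic] [W.IsGloballyMinimal] {N : ℕ} [NeZero N]
      (f : CuspForm (Gamma0 N) 2) (κ : ZpExtension ℚ 2) (γ : absoluteGaloisGroup ℚ),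
      κ.IsCyclotomic → IsOrdinaryAt W 2 → W.HasIrreducibleModPGaloisRep 2 → ¬ W.HasSurjectiveModNGaloisRep 2 →
      κ.IsTopGenerator γ → IsCyclotomicVariable 2 γ → IsNewformOf W f →
      ∀ (D : W.SelmerDualData κ γ) (Y : W.FineSelmerDualData κ γ),
        ∃ (P : Submodule (IwasawaAlgebra 2) (IwasawaAlgebra 2)) (M : Submodule (IwasawaAlgebra 2) P)
          (τ : P →ₗ[IwasawaAlgebra 2] D.X) (π : D.X →ₗ[IwasawaAlgebra 2] Y.X),
          (∀ m ∈ M, τ m = 0) ∧ Function.Surjective π ∧ Function.Exact τ π ∧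
          ∀ G₁ : IwasawaAlgebra 2, iwasawaToPowerSeries 2 G₁ = padicLFunction f (unitRoot W 2 : ℚ_[2]) →
            ∃ s : IwasawaAlgebra 2, s ∉ IwasawaAlgebra.augIdealP 2 ∧ s * G₁ ∈ Submodule.map P.subtype M)
    (hA3 : ∀ (W : WeierstrassCurve ℚ) [W.IsElliptic] [W.IsGloballyMinimal],
      GoodOrd W 2 → W.HasIrreducibleModPGaloisRep 2 → ¬ W.HasSurjectiveModNGaloisRep 2 →
      ∀ κ : ZpExtension ℚ 2, κ.IsCyclotomic → Set.Finite {s : W.fineSelmerInfty κ | 2 • s = 0})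
    (hOptRed : ∀ (W : WeierstrassCurve ℚ) [W.IsElliptic] [W.IsGloballyMinimal],
      ¬ W.HasCM → GoodOrd W 2 → ¬ W.HasIrreducibleModPGaloisRep 2 →
      ∀ (W₀ : WeierstrassCurve ℚ) [W₀.IsElliptic] [W₀.IsGloballyMinimal] {N₀ : ℕ} [NeZero N₀]
        (D₀ : ModularParametrizationData W₀ N₀), WeierstrassCurve.IsIsogenous W W₀ →
        (∀ z ∈ D₀.L.lattice, ∃ w ∈ periodLattice D₀.f, z = D₀.c * w) →
        O1.KatoMuPartAtTwo W₀ ∨ ∃ x y : ℚ, W₀.toAffine.Equation x y ∧ 2 * y + W₀.a₁ * x + W₀.a₃ = 0 ∧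
          ((TwoTorsionRamifiedAtTwo x ∧ ¬ TwoTorsionOdd W₀ x) ∨
            (TwoTorsionOdd W₀ x ∧ ¬ TwoTorsionRamifiedAtTwo x))) :
    KatoMuPartOff514AtOptimalMemberOfNotSurjectiveTwo :=
  katoMuPartOff514_of_split hAU (katoMuPartIrrNotSurjectiveTwo_of_colemanMuPackage_of_finite_fineSelmer hC3 hA3)
    (katoMuPartOff514Reducible_of_optimalMember hAU hMod hOptRed)

/-- **The route's child `OrdKatoMuPartOptimalAtTwo` (stmt-BirchSwinnertonDyer-23921, text = B7′ verbatim) BY NAME from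
the same five displayed inputs.** Conditional; the item is NOT closed by this; nothing asserted.
[cite: AbbesUllmo1996, Thm. A] [cite: EdixhovenManin1991, Prop. 2] [cite: GreenbergLNM1716, Prop. 5.14, Conj. 1.11 (shape)] -/
theorem ordKatoMuPartOptimalAtTwo_of_C3Binders_of_optimalMemberReducible
    (hAU : abbesUllmo_not_dvd_maninConstant_of_not_dvd_level) (hMod : nonempty_modularParametrizationData)
    (hC3 : ∀ (W : WeierstrassCurve ℚ) [W.IsElliptic] [W.IsGloballyMinimal] {N : ℕ} [NeZero N]
      (f : CuspForm (Gamma0 N) 2) (κ : ZpExtension ℚ 2) (γ : absoluteGaloisGroup ℚ),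
      κ.IsCyclotomic → IsOrdinaryAt W 2 → W.HasIrreducibleModPGaloisRep 2 → ¬ W.HasSurjectiveModNGaloisRep 2 →
      κ.IsTopGenerator γ → IsCyclotomicVariable 2 γ → IsNewformOf W f →
      ∀ (D : W.SelmerDualData κ γ) (Y : W.FineSelmerDualData κ γ),
        ∃ (P : Submodule (IwasawaAlgebra 2) (IwasawaAlgebra 2)) (M : Submodule (IwasawaAlgebra 2) P)
          (τ : P →ₗ[IwasawaAlgebra 2] D.X) (π : D.X →ₗ[IwasawaAlgebra 2] Y.X),
          (∀ m ∈ M, τ m = 0) ∧ Function.Surjective π ∧ Function.Exact τ π ∧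
          ∀ G₁ : IwasawaAlgebra 2, iwasawaToPowerSeries 2 G₁ = padicLFunction f (unitRoot W 2 : ℚ_[2]) →
            ∃ s : IwasawaAlgebra 2, s ∉ IwasawaAlgebra.augIdealP 2 ∧ s * G₁ ∈ Submodule.map P.subtype M)
    (hA3 : ∀ (W : WeierstrassCurve ℚ) [W.IsElliptic] [W.IsGloballyMinimal],
      GoodOrd W 2 → W.HasIrreducibleModPGaloisRep 2 → ¬ W.HasSurjectiveModNGaloisRep 2 →
      ∀ κ : ZpExtension ℚ 2, κ.IsCyclotomic → Set.Finite {s : W.fineSelmerInfty κ | 2 • s = 0})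
    (hOptRed : ∀ (W : WeierstrassCurve ℚ) [W.IsElliptic] [W.IsGloballyMinimal],
      ¬ W.HasCM → GoodOrd W 2 → ¬ W.HasIrreducibleModPGaloisRep 2 →
      ∀ (W₀ : WeierstrassCurve ℚ) [W₀.IsElliptic] [W₀.IsGloballyMinimal] {N₀ : ℕ} [NeZero N₀]
        (D₀ : ModularParametrizationData W₀ N₀), WeierstrassCurve.IsIsogenous W W₀ →
        (∀ z ∈ D₀.L.lattice, ∃ w ∈ periodLattice D₀.f, z = D₀.c * w) →
        O1.KatoMuPartAtTwo W₀ ∨ ∃ x y : ℚ, W₀.toAffine.Equation x y ∧ 2 * y + W₀.a₁ * x + W₀.a₃ = 0 ∧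
          ((TwoTorsionRamifiedAtTwo x ∧ ¬ TwoTorsionOdd W₀ x) ∨
            (TwoTorsionOdd W₀ x ∧ ¬ TwoTorsionRamifiedAtTwo x))) :
    OrdKatoMuPartOptimalAtTwo :=
  katoMuPartOff514_of_C3Binders_of_optimalMemberReducible hAU hMod hC3 hA3 hOptRed

end Summit.BirchSwinnertonDyer.BirchSwinnertonDyer.Theorems.SteinbergFibreAtTwo

end
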